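import Literature.AlgebraicGeometry.Motives.MumfordTateRankInvariance
import Literature.AlgebraicGeometry.Motives.MumfordTateInvariantsLieStabilizer
import Literature.AlgebraicGeometry.Motives.HodgeTensorHodgeGroupEndAlgProofs
import Literature.AlgebraicGeometry.Motives.HodgeClassesBoundedNormFinite
import HarnessLib

/-!
# Type stability of Hodge classes under automorphisms normalising the generic Mumford–Tate Lie algebra

Family `hodge`, layer `Literature/AlgebraicGeometry/Motives` (fact seat of
`HodgeTheory.bku_finite_monodromyOrbit_of_isHodgeGenericIn`, Baldi–Klingler–Ullmo §3.2). The
ALGEBRAIC half of the classical argument "at a Hodge-generic point the monodromy translates of a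
Hodge class are Hodge classes" (Deligne, *La conjecture de Weil pour les surfaces K3* (1972),
Prop. 7.5; André 1992, Thm. 1; Klingler, ICM 2022, §2.6;
Baldi–Klingler–Ullmo §3.1–3.2), over the tree's Mumford–Tate vocabulary (`Motives/HodgeTensor`,
`Motives/AtypicalHodgeLocus`, `Motives/MumfordTateInvariants*`), for an ABSTRACT family `𝓗` of Hodge
structures on one finite-dimensional `ℚ`-space `V` (in the application: the Hodge structures of the
fibres of a family transported to the fibre at `s` along all paths) and an automorphism `g` of `V`
under which `𝓗` is stable (a monodromy transformation):

* `HodgeStructure.apply_mem_hodgeClasses_of_generic` — if `H₀ ∈ 𝓗` is polarizable and of MAXIMAL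
  Mumford–Tate rank in `𝓗` (`HodgeStructure.mtRank`, BKU §3.2 "Hodge-generic"), and some `H₁ ∈ 𝓗`
  is GENERIC in the sense that each of its weight-`0` Hodge tensors is a Hodge tensor for every
  member of `𝓗` (Deligne's Hodge-generic points, outside the meagre set of Deligne 1972, Prop. 7.5 /
  Klingler ICM 2022 §2.6), then `g` maps
  the Hodge classes `Hdgᵖ(H₀)` (`n = 2p`) into themselves.

Proof (Deligne–André): the annihilator `𝔤` of the GENERIC Hodge tensors (those Hodge for all of `𝓗`)
contains every `𝔪𝔱(H)`, `H ∈ 𝓗`, equals `𝔪𝔱(H₁)`, hence has dimension `≤ rk 𝔪𝔱(H₀)` and so EQUALS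
`𝔪𝔱(H₀)`; it is normalised by `g` (equivariance of the derivation action,
`tensorSpaceCongr_tensorSpaceDeriv`); the line `ℚ v` of a Hodge class `v` of `H₀` is
`𝔪𝔱(H₀)`-stable (polarization: the rank-one Hodge endomorphism `w ↦ Q(v, w) v` is a Hodge tensor of
`T^{1,1}`, which `𝔪𝔱` kills — `apply_mem_span_of_mem_hodgeClasses`), hence `𝔪𝔱(g^* H₀)`-stable, and
an `𝔪𝔱`-stable rational line of a Hodge structure of weight `2p` consists of Hodge classes (the
grading operator `Θ` lies in `𝔪𝔱_ℂ`, `gradingEnd_mem_span_lieStabilizer`; a real `Θ`-eigenvector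
has degree `p` — `mem_hodgeClasses_of_forall_apply_mem_span`). Also: the two spellings of the
Mumford–Tate Lie algebra in the tree agree (`mumfordTateLieAlgebra_eq_lieStabilizer`).

Everything is a theorem; no definition and no named fact is introduced (D-0026). The ANALYTIC half
(existence of a generic `H₁`: holomorphic variation of the Hodge filtration, analyticity of Hodge
loci, Baire) is not here.

## References

* [Deligne1972WeilK3] P. Deligne, La conjecture de Weil pour les surfaces K3, Invent. Math. 15
  (1972), Prop. 7.5.
* [Klingler2022HodgeICM] B. Klingler, Hodge theory, between algebraicity and transcendence, ICM 2022,
  §2.6.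
* [DeligneHodgeII1971] P. Deligne, Théorie de Hodge II, Publ. Math. IHÉS 40 (1971), §4.2.
* [Andre1992] Y. André, Mumford–Tate groups of mixed Hodge structures and the theorem of the fixed
  part, Compositio Math. 82 (1992), Thm. 1.
* [BaldiKlinglerUllmo2024] G. Baldi, B. Klingler, E. Ullmo, On the distribution of the Hodge locus,
  Invent. Math. 235 (2024), §3.1–3.2.
* [Deligne1982HodgeCycles] P. Deligne, Hodge cycles on abelian varieties, LNM 900 (1982), I §3,
  Prop. 3.4 (and its proof).
* [GreenGriffithsKerr2012] M. Green, P. Griffiths, M. Kerr, Mumford–Tate groups and domains (2012),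
  (I.B.1), (I.B.5).
-/

noncomputable section

open scoped TensorProduct PiTensorProduct

universe u

namespace Literature.AlgebraicGeometry.Motives

variable {V : Type u} [AddCommGroup V] [Module ℚ V]

/-! ### The two spellings of the derivation action agree -/

/-- `tensorPowerDeriv` (`Motives/AtypicalHodgeLocus`) is `piTensorDerivation`
(`Motives/MumfordTateInvariantsDerivation`): both are `X · (⊗ vₖ) = Σₖ ⋯ ⊗ X vₖ ⊗ ⋯`. [folklore] -/
theorem tensorPowerDeriv_eq_piTensorDerivation (r : ℕ) (X : Module.End ℚ V) :
    tensorPowerDeriv V r X = piTensorDerivation r X := by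
  ext v
  simp only [LinearMap.compMultilinearMap_apply, tensorPowerDeriv_tprod, piTensorDerivation_tprod]

/-- `tensorSpaceDeriv` (`Motives/AtypicalHodgeLocus`) is `tensorDerivation`
(`Motives/MumfordTateInvariantsDerivation`) on `T^{a,b} V`. [folklore] -/
theorem tensorSpaceDeriv_eq_tensorDerivation (a b : ℕ) (X : Module.End ℚ V)
    (t : hodgeTensorSpace V a b) : tensorSpaceDeriv V a b X t = tensorDerivation a b X t := by
  induction t using TensorProduct.induction_on with
  | zero => simp
  | add x y hx hy => rw [map_add, map_add, hx, hy]
  | tmul x ξ =>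
    rw [tensorSpaceDeriv_tmul, tensorDerivation_apply, LinearMap.sub_apply, LinearMap.rTensor_tmul,
      LinearMap.lTensor_tmul, tensorPowerDeriv_eq_piTensorDerivation,
      tensorPowerDeriv_eq_piTensorDerivation]

namespace HodgeStructure

variable [Module.Finite ℚ V] [HodgeTensorFacts.{u, u}] {n : ℤ}

/-- **The two spellings of the Mumford–Tate Lie algebra agree**: `mumfordTateLieAlgebra H`
(`Motives/AtypicalHodgeLocus`, through `tensorSpaceDeriv`) is `lieStabilizer H`
(`Motives/MumfordTateInvariantsLieStabilizer`, through `tensorDerivation`). [folklore] -/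
theorem mumfordTateLieAlgebra_eq_lieStabilizer (H : HodgeStructure V n) :
    H.mumfordTateLieAlgebra = H.lieStabilizer := by
  ext X
  simp only [mem_mumfordTateLieAlgebra_iff, mem_lieStabilizer_iff, tensorSpaceDeriv_eq_tensorDerivation]

/-! ### Hodge classes span `𝔪𝔱`-stable lines (polarizable case) -/

omit [Module.Finite ℚ V] [HodgeTensorFacts.{u, u}] in
/-- Complexification of the rank-one endomorphism `w ↦ Q(v, w) v`: it is `x ↦ Q_ℂ(1 ⊗ v, x) (1 ⊗ v)`.
[folklore] -/
theorem baseChange_smulRight_apply (Q : LinearMap.BilinForm ℚ V) (v : V) (x : ℂ ⊗[ℚ] V) :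
    ((Q v).smulRight v).baseChange ℂ x = Q.baseChange ℂ (ofRat v) x • ofRat v := by
  induction x using TensorProduct.induction_on with
  | zero => simp
  | add x y hx hy => rw [map_add, map_add, hx, hy, add_smul]
  | tmul c w =>
    rw [LinearMap.baseChange_tmul, LinearMap.smulRight_apply, ofRat_apply,
      LinearMap.BilinForm.baseChange_tmul, one_mul, TensorProduct.tmul_smul,
      TensorProduct.smul_tmul', Algebra.smul_def, TensorProduct.smul_tmul', smul_eq_mul, mul_one]

omit [Module.Finite ℚ V] [HodgeTensorFacts.{u, u}] in
/-- **For a Hodge class `v` (`n = 2p`), the rank-one endomorphism `w ↦ Q(v, w) v` is a Hodge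
endomorphism** (`endAlg`): its complexification `x ↦ Q_ℂ(v, x) v` maps `Fʳ` into `ℂ v ⊆ Fᵖ ⊆ Fʳ`
for `r ≤ p` and kills `Fʳ ⊆ F^{p+1} = F^{n+1-p}` for `r > p` (first Hodge–Riemann relation).
[cite: Deligne1982HodgeCycles, I §3 (proof of Prop. 3.4)] -/
theorem Polarization.smulRight_mem_endAlg {H : HodgeStructure V n} (Q : Polarization H) {p : ℤ}
    (hn : p + p = n) {v : V} (hv : v ∈ H.hodgeClasses p) :
    ((Q.form v).smulRight v : Module.End ℚ V) ∈ H.endAlg := by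
  rw [mem_endAlg_iff]
  intro r
  rintro _ ⟨x, hx, rfl⟩
  rw [baseChange_smulRight_apply]
  rcases le_or_gt r p with hr | hr
  · exact Submodule.smul_mem _ _ (H.antitone_F hr ((mem_hodgeClasses_iff H p v).1 hv))
  · have hx' : x ∈ H.F (n + 1 - p) := H.antitone_F (by omega) hx
    rw [Q.form_apply_eq_zero p (ofRat v) hv x hx', zero_smul]
    exact Submodule.zero_mem _

/-- **`𝔰 = Lie MT` commutes with every Hodge endomorphism** (`X a = a X` for `X ∈ lieStabilizer H`,
`a ∈ End_Hdg(V)`): the tensor `t_a ∈ T^{1,1}` of `a` is a weight-`0` Hodge tensor of type `(0,0)`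
(`sum_tprod_tmul_tprod_coord_mem_hodgeClasses`), so `ρ(X) t_a = t_{[X,a]} = 0`. The proof of
`commute_of_mem_hodgeLie` (`Motives/ZarhinHodgeGroupLieAlgebra`) verbatim, for the larger Lie
algebra `𝔰 ⊇ 𝔥`. [cite: Deligne1982HodgeCycles, I Prop. 3.4] -/
theorem commute_of_mem_lieStabilizer (H : HodgeStructure V n) {X : Module.End ℚ V}
    (hX : X ∈ H.lieStabilizer) (a : H.endAlg) :
    X * (a : Module.End ℚ V) = (a : Module.End ℚ V) * X := by
  classical
  set b := Module.finBasis ℚ V with hb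
  obtain ⟨t, ht⟩ : ∃ t : hodgeTensorSpace V 1 1, t =
      ∑ i, PiTensorProduct.tprod ℚ (fun _ : Fin 1 => (a : Module.End ℚ V) (b i)) ⊗ₜ[ℚ]
        PiTensorProduct.tprod ℚ (fun _ : Fin 1 => b.coord i) := ⟨_, rfl⟩
  have hmem : t ∈ (H.tensorSpace 1 1).hodgeClasses 0 :=
    ht ▸ sum_tprod_tmul_tprod_coord_mem_hodgeClasses H a b
  have hkill : tensorDerivation 1 1 X t = 0 :=
    (H.mem_lieStabilizer_iff X).1 hX 1 1 (by simp) t hmem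
  have key : ∀ (f : Module.Dual ℚ V) (v : V),
      f (X ((a : Module.End ℚ V) v)) - f ((a : Module.End ℚ V) (X v)) = 0 := by
    intro f v
    obtain ⟨μ, hμ⟩ : ∃ μ : hodgeTensorSpace V 1 1 →ₗ[ℚ] ℚ, μ =
      LinearMap.mul' ℚ ℚ ∘ₗ TensorProduct.map
        (PiTensorProduct.lift ((MultilinearMap.mkPiAlgebra ℚ (Fin 1) ℚ).compLinearMap fun _ => f))
        (PiTensorProduct.lift ((MultilinearMap.mkPiAlgebra ℚ (Fin 1) ℚ).compLinearMap
          fun _ => Module.Dual.eval ℚ V v)) := ⟨_, rfl⟩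
    have hμapply : ∀ (x : Fin 1 → V) (φ : Fin 1 → Module.Dual ℚ V),
        μ (PiTensorProduct.tprod ℚ x ⊗ₜ[ℚ] PiTensorProduct.tprod ℚ φ) = f (x 0) * φ 0 v := by
      intro x φ
      simp [hμ, MultilinearMap.mkPiAlgebra_apply, Module.Dual.eval_apply]
    have hD : ∀ i : Fin (Module.finrank ℚ V), tensorDerivation 1 1 X
        (PiTensorProduct.tprod ℚ (fun _ : Fin 1 => (a : Module.End ℚ V) (b i)) ⊗ₜ[ℚ]
          PiTensorProduct.tprod ℚ (fun _ : Fin 1 => b.coord i)) =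
        PiTensorProduct.tprod ℚ (fun _ : Fin 1 => X ((a : Module.End ℚ V) (b i))) ⊗ₜ[ℚ]
            PiTensorProduct.tprod ℚ (fun _ : Fin 1 => b.coord i) -
          PiTensorProduct.tprod ℚ (fun _ : Fin 1 => (a : Module.End ℚ V) (b i)) ⊗ₜ[ℚ]
            PiTensorProduct.tprod ℚ (fun _ : Fin 1 => (b.coord i).comp X) := by
      intro i
      rw [tensorDerivation_tmul_tprod, Fin.sum_univ_one, Fin.sum_univ_one]
      congr 3
      · funext m; simp [Fin.fin_one_eq_zero m]
      · funext m; simp [Fin.fin_one_eq_zero m]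
    have h := congrArg μ hkill
    rw [ht, map_sum, map_sum, map_zero] at h
    simp_rw [hD, map_sub, hμapply, LinearMap.comp_apply, Module.Basis.coord_apply] at h
    rw [Finset.sum_sub_distrib] at h
    have e1 := apply_apply_eq_sum_repr b f (X * (a : Module.End ℚ V)) v
    simp only [Module.End.mul_apply] at e1
    rw [e1, apply_apply_eq_sum_repr b f (a : Module.End ℚ V) (X v)]
    exact h
  apply LinearMap.ext fun v => ?_
  rw [← sub_eq_zero, ← Module.forall_dual_apply_eq_zero_iff ℚ]
  intro f
  rw [map_sub]
  exact key f v

/-- **The line of a Hodge class is `𝔪𝔱`-stable** (polarizable case): for `v ∈ Hdgᵖ(H)`, `n = 2p`,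
and `X ∈ 𝔰 = lieStabilizer H`, `X v ∈ ℚ v`. Indeed `X` commutes with `a : w ↦ Q(v, w) v`
(`commute_of_mem_lieStabilizer`, `Polarization.smulRight_mem_endAlg`), so
`Q(v, v) X v = X (a v) = a (X v) = Q(v, X v) v`, and `Q(v, v) > 0`
(`Polarization.form_self_pos_of_mem_hodgeClasses`). [cite: Deligne1982HodgeCycles, I Prop. 3.4]
[cite: GreenGriffithsKerr2012, I.B.5] -/
theorem apply_mem_span_of_mem_hodgeClasses {H : HodgeStructure V n} (Q : Polarization H) {p : ℤ}
    (hn : p + p = n) {v : V} (hv : v ∈ H.hodgeClasses p) {X : Module.End ℚ V}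
    (hX : X ∈ H.lieStabilizer) : X v ∈ ℚ ∙ v := by
  by_cases hv0 : v = 0
  · rw [hv0, map_zero]
    exact Submodule.zero_mem _
  have hpos : 0 < Q.form v v := Q.form_self_pos_of_mem_hodgeClasses hn hv hv0
  have hcomm := H.commute_of_mem_lieStabilizer hX ⟨_, Q.smulRight_mem_endAlg hn hv⟩
  have h := LinearMap.congr_fun hcomm v
  simp only [Module.End.mul_apply, LinearMap.smulRight_apply, map_smul] at h
  rw [Submodule.mem_span_singleton]
  refine ⟨(Q.form v v)⁻¹ * Q.form v (X v), ?_⟩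
  rw [mul_smul, ← h, smul_smul, inv_mul_cancel₀ hpos.ne', one_smul]

/-! ### An `𝔪𝔱`-stable rational line consists of Hodge classes -/

/-- **A rational line stable under `𝔰 = Lie MT(H)` consists of Hodge classes** (Green–Griffiths–Kerr
(I.B.5), "a subspace is a sub-Hodge structure iff it is `M`-stable", the rank-one case in
infinitesimal form): if `X v ∈ ℚ v` for all `X ∈ lieStabilizer H` then `v ∈ Hdgᵖ(H)` (`n = 2p`).
Proof: the Hodge grading operator `Θ` of a graded basis `e` of `V_ℂ` lies in `ℂ ⊗ 𝔰`
(`gradingEnd_mem_span_lieStabilizer`, Deligne's "`μ(𝔾ₘ) ⊆ MT`"), so `1 ⊗ v` is a `Θ`-eigenvector,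
i.e. all its coordinates sit in one degree `d`; being real, `1 ⊗ v ∈ Fᵈ ∩ conj Fᵈ` forces
`d ≤ n - d` and `n - d ≤ d`, so `d = p` and `1 ⊗ v ∈ Fᵖ`. [cite: GreenGriffithsKerr2012, I.B.5]
[cite: Deligne1982HodgeCycles, I proof of Prop. 3.4] -/
theorem mem_hodgeClasses_of_forall_apply_mem_span (H : HodgeStructure V n) {p : ℤ} (hn : p + p = n)
    {v : V} (hst : ∀ X ∈ H.lieStabilizer, X v ∈ ℚ ∙ v) : v ∈ H.hodgeClasses p := by
  classical
  by_cases hv0 : v = 0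
  · rw [hv0]
    exact Submodule.zero_mem _
  obtain ⟨S, deg, e, hF, hFc⟩ := exists_basis_F_eq_span H
  haveI : Fintype S := FiniteDimensional.fintypeBasisIndex e
  set x : ℂ ⊗[ℚ] V := ofRat v with hxdef
  have hx0 : x ≠ 0 := fun h ↦ hv0 (ofRat_injective (by rw [← hxdef, h, map_zero]))
  -- `Θ x ∈ ℂ x`
  have key : ∀ Y ∈ Submodule.span ℂ
      ((fun X : Module.End ℚ V => X.baseChange ℂ) '' (H.lieStabilizer : Set (Module.End ℚ V))),
      Y x ∈ (ℂ ∙ x : Submodule ℂ (ℂ ⊗[ℚ] V)) := by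
    intro Y hY
    induction hY using Submodule.span_induction with
    | mem Y hY =>
      obtain ⟨X, hX, rfl⟩ := hY
      obtain ⟨c, hc⟩ := Submodule.mem_span_singleton.1 (hst X hX)
      rw [hxdef, baseChange_ofRat, ← hc, map_smul]
      exact Submodule.smul_of_tower_mem _ c (Submodule.mem_span_singleton_self _)
    | zero => simp
    | add Y Z _ _ hY hZ =>
      rw [LinearMap.add_apply]
      exact Submodule.add_mem _ hY hZ
    | smul c Y _ hY =>
      rw [LinearMap.smul_apply]
      exact Submodule.smul_mem _ c hY
  obtain ⟨μ, hμ⟩ := Submodule.mem_span_singleton.1 (key _ (gradingEnd_mem_span_lieStabilizer H e hF hFc))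
  -- all coordinates of `x` sit in the degree `μ`
  have hcoord : ∀ σ, e.repr x σ ≠ 0 → (deg σ : ℂ) = μ := by
    intro σ hσ
    have h1 : e.repr (gradingEnd e deg x) σ = (deg σ : ℂ) * e.repr x σ := by
      have hx : gradingEnd e deg x = ∑ τ, (e.repr x τ * (deg τ : ℂ)) • e τ := by
        conv_lhs => rw [← e.sum_repr x]
        simp only [map_sum, map_smul, gradingEnd_apply_basis, smul_smul]
      rw [hx, e.repr_sum_self]
      simp [mul_comm]
    have h2 : e.repr (gradingEnd e deg x) σ = μ * e.repr x σ := by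
      rw [← hμ, map_smul, Finsupp.coe_smul, Pi.smul_apply, smul_eq_mul]
    exact mul_right_cancel₀ hσ (h1.symm.trans h2)
  -- the common degree `d`
  obtain ⟨σ₀, hσ₀⟩ : ∃ σ₀, e.repr x σ₀ ≠ 0 := by
    by_contra hall
    push Not at hall
    exact hx0 (e.repr.injective (by ext σ; simp [hall σ]))
  set d : ℤ := deg σ₀ with hddef
  have hsupp : ∀ σ, e.repr x σ ≠ 0 → deg σ = d := by
    intro σ hσ
    have h := (hcoord σ hσ).trans (hcoord σ₀ hσ₀).symm
    exact_mod_cast h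
  have hmem : ∀ T : Set S, {σ | deg σ = d} ⊆ T → x ∈ Submodule.span ℂ (e '' T) := by
    intro T hT
    rw [Module.Basis.mem_span_image]
    intro σ hσ
    exact hT (hsupp σ (Finsupp.mem_support_iff.1 hσ))
  have hdeg : ∀ T : Set S, x ∈ Submodule.span ℂ (e '' T) → ∀ σ, e.repr x σ ≠ 0 → σ ∈ T := by
    intro T hT σ hσ
    rw [Module.Basis.mem_span_image] at hT
    exact hT (Finsupp.mem_support_iff.2 hσ)
  have hconj : conj x = x := by rw [hxdef, conj_ofRat]
  -- `x ∈ Fᵈ`, hence `x = conj x ∈ conj Fᵈ = span {deg ≤ n - d}`: `d ≤ n - d`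
  have h1 : d ≤ n - d := by
    have hxF : x ∈ H.F d := by
      rw [hF d]
      exact hmem _ fun σ (hσ : deg σ = d) ↦ le_of_eq hσ.symm
    have hx' : x ∈ complexConj (H.F d) := by rw [mem_complexConj, hconj]; exact hxF
    rw [hFc d] at hx'
    exact (hsupp σ₀ hσ₀) ▸ hdeg _ hx' σ₀ hσ₀
  -- `x ∈ span {deg ≤ d} = conj F^{n-d}`, hence `x = conj x ∈ F^{n-d} = span {n - d ≤ deg}`
  have h2 : n - d ≤ d := by
    have hx' : x ∈ complexConj (H.F (n - d)) := by
      rw [hFc (n - d)]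
      exact hmem _ fun σ (hσ : deg σ = d) ↦ by simp only [Set.mem_setOf_eq]; omega
    rw [mem_complexConj, hconj, hF (n - d)] at hx'
    exact (hsupp σ₀ hσ₀) ▸ hdeg _ hx' σ₀ hσ₀
  have hdp : d = p := by omega
  rw [mem_hodgeClasses_iff, hF p]
  exact hmem _ fun σ (hσ : deg σ = d) ↦ by simp only [Set.mem_setOf_eq]; omega

/-! ### The inverse action on tensors -/

omit [Module.Finite ℚ V] [HodgeTensorFacts.{u, u}] in
/-- `(g·)⁻¹ = g⁻¹·` on `T^{a,b}` (copy of `tensorSpaceAct_symm_apply`,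
`Motives/MumfordTateInvariantsXiHodge`, not imported). [folklore] -/
private theorem tensorSpaceAct_symm_apply' {a b : ℕ} (g : V ≃ₗ[ℚ] V) (x : hodgeTensorSpace V a b) :
    (tensorSpaceAct g).symm x = tensorSpaceAct g.symm x := by
  rw [LinearEquiv.symm_apply_eq, ← tensorSpaceAct_mul_apply]
  change x = tensorSpaceAct (g * g⁻¹) x
  rw [mul_inv_cancel, tensorSpaceAct_one]
  rfl

/-! ### The theorem -/

/-- **Type stability under automorphisms normalising the generic Mumford–Tate Lie algebra**
(Deligne 1972, Prop. 7.5; André 1992, Thm. 1; Baldi–Klingler–Ullmo §3.1–3.2 — the algebraic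
half). Let `𝓗` be a family of Hodge structures of weight `n = 2p` on the finite-dimensional `V`,
`H₀ ∈ 𝓗` polarizable of MAXIMAL Mumford–Tate rank in `𝓗`, and suppose some `H₁ ∈ 𝓗` is generic:
every weight-`0` Hodge tensor of type `(0,0)` of `H₁` is one for every `H ∈ 𝓗`. Then every
automorphism `g` of `V` with `g^* 𝓗 ⊆ 𝓗` (`H.comapEquiv g ∈ 𝓗` for `H ∈ 𝓗`) preserves the Hodge
classes of `H₀`: `g v ∈ Hdgᵖ(H₀)` for `v ∈ Hdgᵖ(H₀)`. See the module docstring for the proof.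
[cite: Deligne1972WeilK3, Prop. 7.5] [cite: Klingler2022HodgeICM, §2.6] [cite: Andre1992, Thm. 1]
[cite: BaldiKlinglerUllmo2024, §3.2] -/
theorem apply_mem_hodgeClasses_of_generic {p : ℤ} (hn : p + p = n) (𝓗 : Set (HodgeStructure V n))
    {H₀ : HodgeStructure V n} (h₀ : H₀ ∈ 𝓗) (hpol : H₀.IsPolarizable)
    (hmax : ∀ H ∈ 𝓗, H.mtRank ≤ H₀.mtRank)
    (hgen : ∃ H₁ ∈ 𝓗, ∀ a b : ℕ, ((a : ℤ) - b) * n = 0 →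
      ∀ t ∈ (H₁.tensorSpace a b).hodgeClasses 0, ∀ H ∈ 𝓗, t ∈ (H.tensorSpace a b).hodgeClasses 0)
    (g : V ≃ₗ[ℚ] V) (hg : ∀ H ∈ 𝓗, H.comapEquiv g ∈ 𝓗)
    {v : V} (hv : v ∈ H₀.hodgeClasses p) : g v ∈ H₀.hodgeClasses p := by
  classical
  obtain ⟨Q⟩ := hpol
  -- the annihilator `𝔤` of the generic Hodge tensors
  set 𝔤 : Submodule ℚ (Module.End ℚ V) :=
    ⨅ (a : ℕ) (b : ℕ) (_ : ((a : ℤ) - b) * n = 0) (t : hodgeTensorSpace V a b)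
      (_ : ∀ H ∈ 𝓗, t ∈ (H.tensorSpace a b).hodgeClasses 0),
      LinearMap.ker ((LinearMap.applyₗ t).comp (tensorSpaceDeriv V a b)) with h𝔤def
  have mem𝔤 : ∀ X : Module.End ℚ V, X ∈ 𝔤 ↔ ∀ a b : ℕ, ((a : ℤ) - b) * n = 0 →
      ∀ t : hodgeTensorSpace V a b, (∀ H ∈ 𝓗, t ∈ (H.tensorSpace a b).hodgeClasses 0) →
        tensorSpaceDeriv V a b X t = 0 := by
    intro X
    simp only [h𝔤def, Submodule.mem_iInf, LinearMap.mem_ker, LinearMap.comp_apply, LinearMap.applyₗ_apply_apply]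
  -- (1) `𝔪𝔱(H) ⊆ 𝔤` for `H ∈ 𝓗`
  have hle : ∀ H ∈ 𝓗, H.mumfordTateLieAlgebra ≤ 𝔤 := by
    intro H hH X hX
    rw [mem𝔤]
    intro a b hab t ht
    exact (H.mem_mumfordTateLieAlgebra_iff X).1 hX a b hab t (ht H hH)
  -- (2) `𝔤 = 𝔪𝔱(H₁)`, so `𝔪𝔱(H₀) = 𝔤` by maximality of the rank
  obtain ⟨H₁, h₁, hH₁⟩ := hgen
  have hge : 𝔤 ≤ H₁.mumfordTateLieAlgebra := by
    intro X hX
    rw [mem_mumfordTateLieAlgebra_iff]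
    intro a b hab t ht
    exact (mem𝔤 X).1 hX a b hab t (hH₁ a b hab t ht)
  have h𝔤eq : H₀.mumfordTateLieAlgebra = 𝔤 := by
    refine Submodule.eq_of_le_of_finrank_le (hle H₀ h₀) ?_
    calc Module.finrank ℚ 𝔤 = H₁.mtRank := by rw [le_antisymm hge (hle H₁ h₁)]; rfl
      _ ≤ H₀.mtRank := hmax H₁ h₁
      _ = Module.finrank ℚ H₀.mumfordTateLieAlgebra := rfl
  -- (3) the generic Hodge tensors are stable under `g`, and `𝔤` under `Ad(g⁻¹)`
  have hstab : ∀ (a b : ℕ) (t : hodgeTensorSpace V a b),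
      (∀ H ∈ 𝓗, t ∈ (H.tensorSpace a b).hodgeClasses 0) →
        ∀ H ∈ 𝓗, tensorSpaceAct g t ∈ (H.tensorSpace a b).hodgeClasses 0 := by
    intro a b t ht H hH
    have h := ht (H.comapEquiv g) (hg H hH)
    rw [tensorSpace_comapEquiv, comapEquiv_hodgeClasses, Submodule.mem_comap] at h
    exact h
  have hconj : ∀ X ∈ 𝔤, g.symm.conj X ∈ 𝔤 := by
    intro X hX
    rw [mem𝔤]
    intro a b hab t ht
    have heq := tensorSpaceCongr_tensorSpaceDeriv g.symm a b X ((tensorSpaceAct g.symm).symm t)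
    rw [LinearEquiv.symm_symm] at heq
    change tensorSpaceAct g.symm (tensorSpaceDeriv V a b X ((tensorSpaceAct g.symm).symm t)) =
      tensorSpaceDeriv V a b (g.symm.conj X) (tensorSpaceAct g.symm ((tensorSpaceAct g.symm).symm t)) at heq
    rw [LinearEquiv.apply_symm_apply] at heq
    rw [← heq, (mem𝔤 X).1 hX a b hab _ ?_, map_zero]
    rw [tensorSpaceAct_symm_apply', LinearEquiv.symm_symm]
    exact hstab a b t ht
  -- (4) `H' = g^* H₀`: its Lie algebra is `Ad(g⁻¹) 𝔪𝔱(H₀) ⊆ 𝔤 = 𝔪𝔱(H₀)`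
  set H' := H₀.comapEquiv g with hH'def
  have hH' : ∀ X ∈ H'.lieStabilizer, X ∈ H₀.lieStabilizer := by
    intro X hX
    rw [← mumfordTateLieAlgebra_eq_lieStabilizer, hH'def, mumfordTateLieAlgebra_comapEquiv,
      Submodule.mem_comap, h𝔤eq] at hX
    have h := hconj _ hX
    rw [← mumfordTateLieAlgebra_eq_lieStabilizer, h𝔤eq]
    convert h using 1
    ext w
    simp [LinearEquiv.conj_apply]
  -- the line `ℚ v` is `𝔰(H₀)`-stable, hence `𝔰(H')`-stable, hence `v ∈ Hdgᵖ(H')`, i.e. `g v ∈ Hdgᵖ(H₀)`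
  have hst : ∀ X ∈ H'.lieStabilizer, X v ∈ ℚ ∙ v := fun X hX ↦
    apply_mem_span_of_mem_hodgeClasses Q hn hv (hH' X hX)
  have hvH' : v ∈ H'.hodgeClasses p := H'.mem_hodgeClasses_of_forall_apply_mem_span hn hst
  rw [hH'def, comapEquiv_hodgeClasses, Submodule.mem_comap] at hvH'
  exact hvH'

end HodgeStructure

end Literature.AlgebraicGeometry.Motives

end
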